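import Summits.Ventures.CertifiedManyBodySolver.Observables.SourcedGibbsTrialCapKSpaceUniform
import HarnessLib

/-!
# Pinning-field response MENU on the cell's field grid `h = √2·g` (`g ∈ ℚ`): rational reading rules,
# grid chords, and the HF–BCS k-space cap entry at grid fields (one torus and uniform in `L`)

HONEST FRAMING: zero compute; glue only; NO number is claimed in this file. The hubbard-cq / hubbard-obs pinning
menus live on the field grid `h_tree = √2·g`, `g ∈ {1/28, 1/14, 3/28, 1/7, 5/28, 3/14, 1/4, 2/7, 3/7, 4/7}` (pilot
kill-kits: `A(μ, g) = H − μN − 2g Σ_b s_b (P_b + P_b†)`, i.e. `h = √2 g` in the tree's `dWaveSourceTorusTT' L tp U μ h`).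
Every chord of the row class (`PinningFieldChords` §2: floor `m·2(h − h₁) ≤ lo − hi`, ceiling
`hi − lo ≤ M·2(h₂ − h)`) then has an IRRATIONAL step `2√2 (g − g₁)`, so a literal leaf with RATIONAL slots needs a
decidable side condition: §0 proves the reading rules `8 (g − g₁)² m² ≤ (lo − hi)²` (floor; with `0 ≤ lo − hi`) and
`(hi − lo)² ≤ 8 (g₂ − g)² M²` (ceiling; with `0 ≤ M`), both `norm_num`-decidable on filed rationals — the grid-generic
form of hubbard-cq-p1's `ratCast_mul_two_sqrt_two_div_seven_le` (`g = 1/7`). §1 = the one-torus grid chords at any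
`(t', U, μ)` (floor from a lower cell at `√2 g₁ < √2 g` or at `0`; ceiling from a lower cell at `√2 g₂ > √2 g`).
§2 = the HF–BCS sourced CAP entry at grid fields, `t' = 0`: the certified k-space inequality of
`groundEnergy_dWaveSourceTorus_le_HFBCS_kSpace'` with the field literal simplified to the RATIONAL gap coefficient
`(2√2·h)² = 16 g²` (`E_k = √((ε_k − μ')² + (4 g · dWaveGap k)²)`, exactly the form the certified menu table
evaluates — hubbard-obs-pin-2 `hfbcs-cap/menu/`), giving `SourcedTorusEnergyUpperRow L 0 U μ (√2 g) φ`, the response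
floor against a source-free floor cell, and its rational-slot cell. §3 = uniform in `L`: the two-grid packaging
`sourcedEnergyUpperRow_of_HFBCS_kSpace_grid` at `h = √2 g` (`2√2|h| = 4g`), the floor LEAF on the grid and the stair
`m ≤ liminf_L m_{L+1}(√2 g)`.

What this is NOT: a finite-`h` response floor is a response at an applied pair field — never order, no `h → 0` content
by itself (the order parameter is an infimum over all `h > 0`, `le_dWaveOrderParameterTT'_of_floorAt`); ceilings never
speak to presence; not a superconductivity verdict; no phase sentence. No definition, no named fact, no `sorry`.

Cell `hubbard-obs` (D-0082 (a)/(c-2)), seat `hubbard-obs-pin-2` (`prover-hubbard-obs-pin-2-g3-0`), row «pinning-field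
response menu nodes — Hellmann–Feynman brackets from certified e₀(h ± δh)». References: T. Koma, H. Tasaki,
J. Stat. Phys. 76 (1994) 745, §1 [KomaTasaki1994]; R. B. Griffiths, Phys. Rev. 152 (1966) 240, §II [Griffiths1966];
V. Bach, E. H. Lieb, J. P. Solovej, J. Stat. Phys. 76 (1994) 3, §2 [BachLiebSolovej1994]; P. J. Davis,
P. Rabinowitz, Methods of Numerical Integration (1984) §2.1 [DavisRabinowitz1984].
-/

noncomputable section

namespace Summit.Ventures.CertifiedManyBodySolver.Observables

open Matrix Finset Literature.MathematicalPhysics.QuantumLattice Literature.Probability.LatticeModels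
open Literature.MathematicalPhysics.QuantumLattice.HubbardWave0
open Filter Topology Real
open scoped ComplexOrder

open Summit.Ventures.CertifiedManyBodySolver

/-! ### §0 Arithmetic of the grid `h = √2·g`: positivity, order, rational reading rules -/

section Arithmetic

/-- A positive grid label is a positive field: `0 < √2·g`. [folklore] -/
theorem sqrt_two_mul_ratCast_pos {g : ℚ} (hg : 0 < g) : (0 : ℝ) < Real.sqrt 2 * (g : ℝ) := by
  have : (0 : ℝ) < (g : ℝ) := by exact_mod_cast hg
  positivity

/-- The grid is ordered like its labels: `g₁ < g ⇒ √2·g₁ < √2·g`. [folklore] -/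
theorem sqrt_two_mul_ratCast_lt {g₁ g : ℚ} (hg : g₁ < g) : Real.sqrt 2 * (g₁ : ℝ) < Real.sqrt 2 * (g : ℝ) := by
  have : (g₁ : ℝ) < (g : ℝ) := by exact_mod_cast hg
  exact mul_lt_mul_of_pos_left this (Real.sqrt_pos.2 (by norm_num))

/-- Squared grid step: `(2 (√2 g − √2 g₁))² = 8 (g − g₁)²`. [folklore] -/
theorem sq_two_mul_sqrtTwoStep (g₁ g : ℚ) :
    (2 * (Real.sqrt 2 * (g : ℝ) - Real.sqrt 2 * (g₁ : ℝ))) ^ 2 = 8 * ((g : ℝ) - (g₁ : ℝ)) ^ 2 := by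
  have h2 : Real.sqrt 2 ^ 2 = 2 := Real.sq_sqrt (by norm_num)
  have e : (2 * (Real.sqrt 2 * (g : ℝ) - Real.sqrt 2 * (g₁ : ℝ))) ^ 2 =
      4 * Real.sqrt 2 ^ 2 * ((g : ℝ) - (g₁ : ℝ)) ^ 2 := by ring
  rw [e, h2]; ring

/-- **FLOOR reading rule on the grid.** For rational `m`, slack `s ≥ 0` and labels `g₁, g` with
`8 (g − g₁)² m² ≤ s²` (decidable by `norm_num`), `m · 2(√2 g − √2 g₁) ≤ s` — the side condition `hm` of the floor
chord `PinFieldTorusResponseFloor.of_energyRows` at the grid fields (`s = lo − hi`). [folklore] -/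
theorem ratCast_mul_two_sqrtTwoStep_le {g₁ g m s : ℚ} (hs : 0 ≤ s)
    (hms : 8 * (g - g₁) ^ 2 * m ^ 2 ≤ s ^ 2) :
    ((m : ℚ) : ℝ) * (2 * (Real.sqrt 2 * (g : ℝ) - Real.sqrt 2 * (g₁ : ℝ))) ≤ ((s : ℚ) : ℝ) := by
  have hx : (((m : ℚ) : ℝ) * (2 * (Real.sqrt 2 * (g : ℝ) - Real.sqrt 2 * (g₁ : ℝ)))) ^ 2 =
      8 * ((g : ℝ) - (g₁ : ℝ)) ^ 2 * ((m : ℚ) : ℝ) ^ 2 := by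
    rw [mul_pow, sq_two_mul_sqrtTwoStep]; ring
  have hms' : 8 * ((g : ℝ) - (g₁ : ℝ)) ^ 2 * ((m : ℚ) : ℝ) ^ 2 ≤ ((s : ℚ) : ℝ) ^ 2 := by exact_mod_cast hms
  have hs' : (0 : ℝ) ≤ ((s : ℚ) : ℝ) := by exact_mod_cast hs
  have habs := abs_le_of_sq_le_sq (by rw [hx]; exact hms') hs'
  exact (le_abs_self _).trans habs

/-- Floor reading rule from the source-FREE base field `h₁ = 0` to `h = √2 g`: `8 g² m² ≤ s²`, `0 ≤ s`
give `m · 2(√2 g − 0) ≤ s`. [folklore] -/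
theorem ratCast_mul_two_sqrtTwoMul_le {g m s : ℚ} (hs : 0 ≤ s) (hms : 8 * g ^ 2 * m ^ 2 ≤ s ^ 2) :
    ((m : ℚ) : ℝ) * (2 * (Real.sqrt 2 * (g : ℝ) - 0)) ≤ ((s : ℚ) : ℝ) := by
  have h := ratCast_mul_two_sqrtTwoStep_le (g₁ := 0) (g := g) hs (by simpa using hms)
  simpa using h

/-- **CEILING reading rule on the grid.** For rational `M ≥ 0`, slack `s` and labels `g ≤ g₂` with
`s² ≤ 8 (g₂ − g)² M²` (decidable by `norm_num`), `s ≤ M · 2(√2 g₂ − √2 g)` — the side condition `hM` of the ceiling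
chord `PinFieldTorusResponseCeiling.of_energyRows` (`s = hi − lo`). [folklore] -/
theorem ratCast_le_mul_two_sqrtTwoStep {g g₂ M s : ℚ} (hg : g ≤ g₂) (hM : 0 ≤ M)
    (hsM : s ^ 2 ≤ 8 * (g₂ - g) ^ 2 * M ^ 2) :
    ((s : ℚ) : ℝ) ≤ ((M : ℚ) : ℝ) * (2 * (Real.sqrt 2 * (g₂ : ℝ) - Real.sqrt 2 * (g : ℝ))) := by
  have hy : (((M : ℚ) : ℝ) * (2 * (Real.sqrt 2 * (g₂ : ℝ) - Real.sqrt 2 * (g : ℝ)))) ^ 2 =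
      8 * ((g₂ : ℝ) - (g : ℝ)) ^ 2 * ((M : ℚ) : ℝ) ^ 2 := by
    rw [mul_pow, sq_two_mul_sqrtTwoStep]; ring
  have hsM' : ((s : ℚ) : ℝ) ^ 2 ≤ 8 * ((g₂ : ℝ) - (g : ℝ)) ^ 2 * ((M : ℚ) : ℝ) ^ 2 := by exact_mod_cast hsM
  have hy0 : (0 : ℝ) ≤ ((M : ℚ) : ℝ) * (2 * (Real.sqrt 2 * (g₂ : ℝ) - Real.sqrt 2 * (g : ℝ))) := by
    have h1 : (0 : ℝ) ≤ ((M : ℚ) : ℝ) := by exact_mod_cast hM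
    have h2 : (g : ℝ) ≤ (g₂ : ℝ) := by exact_mod_cast hg
    have h3 : (0 : ℝ) ≤ Real.sqrt 2 * (g₂ : ℝ) - Real.sqrt 2 * (g : ℝ) := by
      rw [← mul_sub]; exact mul_nonneg (Real.sqrt_nonneg 2) (sub_nonneg.2 h2)
    positivity
  have habs : |((s : ℚ) : ℝ)| ≤ ((M : ℚ) : ℝ) * (2 * (Real.sqrt 2 * (g₂ : ℝ) - Real.sqrt 2 * (g : ℝ))) :=
    abs_le_of_sq_le_sq (by rw [hy]; exact hsM') hy0
  exact (le_abs_self _).trans habs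

/-- The field literal at a grid point: `2√2 · (√2 g) = 4 g` (so `(2√2 h)² = 16 g²`, a RATIONAL gap coefficient).
[folklore] -/
theorem two_mul_sqrt_two_mul_sqrt_two_mul (x : ℝ) : 2 * Real.sqrt 2 * (Real.sqrt 2 * x) = 4 * x := by
  have h2 : Real.sqrt 2 * Real.sqrt 2 = 2 := Real.mul_self_sqrt (by norm_num)
  calc 2 * Real.sqrt 2 * (Real.sqrt 2 * x) = 2 * (Real.sqrt 2 * Real.sqrt 2) * x := by ring
    _ = 4 * x := by rw [h2]; ring

/-- `2√2 · |√2 g| = 4 g` for `g ≥ 0` (the Lipschitz constants of the two-grid packaging at a grid field). [folklore] -/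
theorem two_mul_sqrt_two_mul_abs_sqrt_two_mul {x : ℝ} (hx : 0 ≤ x) :
    2 * Real.sqrt 2 * |Real.sqrt 2 * x| = 4 * x := by
  rw [abs_of_nonneg (mul_nonneg (Real.sqrt_nonneg 2) hx), two_mul_sqrt_two_mul_sqrt_two_mul]

/-- Bridge to the B′1 spelling: `√2 · (1/7) = √2/7` (hubbard-cq-p1's `PinningFieldFloorU2`). [folklore] -/
theorem sqrt_two_mul_ratCast_one_div_seven : Real.sqrt 2 * (((1 / 7 : ℚ)) : ℝ) = Real.sqrt 2 / 7 := by
  push_cast; ring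

end Arithmetic

/-! ### §1 One torus at any `(t', U, μ)`: grid chords with rational slots -/

section OneTorus

variable (L : ℕ) [NeZero L] {tp U μ : ℝ}

/-- **Grid FLOOR chord, one torus**: a floor cell at the smaller grid field `√2 g₁` and a cap cell AT `√2 g`, `g₁ < g`,
give `PinFieldTorusResponseFloor L tp U μ (√2 g) m` for every rational `m` with `0 ≤ lo − hi` and
`8 (g − g₁)² m² ≤ (lo − hi)²`. TEMPLATE: `… hlo hhi (by norm_num) (by norm_num)`. [cite: KomaTasaki1994, §1]
[cite: Griffiths1966, §II] -/
theorem pinFieldTorusResponseFloor_sqrtTwoGrid_of_rows {g₁ g lo hi m : ℚ} (hg : g₁ < g)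
    (hlo : SourcedTorusEnergyLowerRow L tp U μ (Real.sqrt 2 * (g₁ : ℝ)) lo)
    (hhi : SourcedTorusEnergyUpperRow L tp U μ (Real.sqrt 2 * (g : ℝ)) hi)
    (hs : 0 ≤ lo - hi) (hm : 8 * (g - g₁) ^ 2 * m ^ 2 ≤ (lo - hi) ^ 2) :
    PinFieldTorusResponseFloor L tp U μ (Real.sqrt 2 * (g : ℝ)) m := by
  refine PinFieldTorusResponseFloor.of_energyRows (sqrt_two_mul_ratCast_lt hg) hlo hhi ?_
  have h := ratCast_mul_two_sqrtTwoStep_le hs hm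
  push_cast at h
  exact h

/-- **Grid FLOOR chord from the source-free base** (`h₁ = 0`, the shape of a gauge-invariant window certificate):
floor cell at `0`, cap cell AT `√2 g`, `0 < g`, `0 ≤ lo − hi`, `8 g² m² ≤ (lo − hi)²` ⇒ floor cell `m` at `√2 g`.
[cite: KomaTasaki1994, §1] [cite: Griffiths1966, §II] -/
theorem pinFieldTorusResponseFloor_sqrtTwoMul_of_rows {g lo hi m : ℚ} (hg : 0 < g)
    (hlo : SourcedTorusEnergyLowerRow L tp U μ 0 lo)
    (hhi : SourcedTorusEnergyUpperRow L tp U μ (Real.sqrt 2 * (g : ℝ)) hi)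
    (hs : 0 ≤ lo - hi) (hm : 8 * g ^ 2 * m ^ 2 ≤ (lo - hi) ^ 2) :
    PinFieldTorusResponseFloor L tp U μ (Real.sqrt 2 * (g : ℝ)) m := by
  refine PinFieldTorusResponseFloor.of_energyRows (sqrt_two_mul_ratCast_pos hg) hlo hhi ?_
  have h := ratCast_mul_two_sqrtTwoMul_le hs hm
  push_cast at h
  exact h

/-- **Grid CEILING chord, one torus**: a cap cell AT `√2 g` and a floor cell at the larger grid field `√2 g₂`,
`g < g₂`, give `PinFieldTorusResponseCeiling L tp U μ (√2 g) M` for every rational `M ≥ 0` with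
`(hi − lo)² ≤ 8 (g₂ − g)² M²`. A ceiling; never speaks to presence. [cite: KomaTasaki1994, §1] [cite: Griffiths1966, §II] -/
theorem pinFieldTorusResponseCeiling_sqrtTwoGrid_of_rows {g g₂ hi lo M : ℚ} (hg : g < g₂)
    (hhi : SourcedTorusEnergyUpperRow L tp U μ (Real.sqrt 2 * (g : ℝ)) hi)
    (hlo : SourcedTorusEnergyLowerRow L tp U μ (Real.sqrt 2 * (g₂ : ℝ)) lo)
    (hM : 0 ≤ M) (hsM : (hi - lo) ^ 2 ≤ 8 * (g₂ - g) ^ 2 * M ^ 2) :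
    PinFieldTorusResponseCeiling L tp U μ (Real.sqrt 2 * (g : ℝ)) M := by
  refine PinFieldTorusResponseCeiling.of_energyRows (sqrt_two_mul_ratCast_lt hg) hhi hlo ?_
  have h := ratCast_le_mul_two_sqrtTwoStep hg.le hM hsM
  push_cast at h
  exact h

/-- **Grid floor read back in tree units, `t' = 0`**: floor cell at `√2 g₁` (or use `…_sqrtTwoMul_…` from `0`) and cap
cell at `√2 g` give `(ℓ − e)/(2(√2 g − √2 g₁)) ≤ m_L(√2 g) = dWaveSourceDensity L U μ (√2 g)`.
[cite: KomaTasaki1994, §1] -/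
theorem dWaveSourceDensity_sqrtTwoGrid_ge_of_rows (U μ : ℝ) {g₁ g ℓ e : ℚ} (hg : g₁ < g)
    (hlo : SourcedTorusEnergyLowerRow L 0 U μ (Real.sqrt 2 * (g₁ : ℝ)) ℓ)
    (hup : SourcedTorusEnergyUpperRow L 0 U μ (Real.sqrt 2 * (g : ℝ)) e) :
    (((ℓ : ℚ) : ℝ) - ((e : ℚ) : ℝ)) / (2 * (Real.sqrt 2 * (g : ℝ) - Real.sqrt 2 * (g₁ : ℝ))) ≤
      dWaveSourceDensity L U μ (Real.sqrt 2 * (g : ℝ)) :=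
  dWaveSourceDensity_ge_of_rows L U μ (sqrt_two_mul_ratCast_lt hg) hlo hup

/-- **Grid floor from the source-free base, tree units, `t' = 0`**: `(ℓ − e)/(2√2 g) ≤ m_L(√2 g)`.
[cite: KomaTasaki1994, §1] -/
theorem dWaveSourceDensity_sqrtTwoMul_ge_of_rows (U μ : ℝ) {g ℓ e : ℚ} (hg : 0 < g)
    (hlo : SourcedTorusEnergyLowerRow L 0 U μ 0 ℓ)
    (hup : SourcedTorusEnergyUpperRow L 0 U μ (Real.sqrt 2 * (g : ℝ)) e) :
    (((ℓ : ℚ) : ℝ) - ((e : ℚ) : ℝ)) / (2 * (Real.sqrt 2 * (g : ℝ))) ≤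
      dWaveSourceDensity L U μ (Real.sqrt 2 * (g : ℝ)) := by
  have h := dWaveSourceDensity_ge_of_rows L U μ (sqrt_two_mul_ratCast_pos hg) hlo hup
  rwa [sub_zero] at h

end OneTorus

/-! ### §2 The HF–BCS sourced CAP at grid fields (`t' = 0`): k-space numerics with the rational gap coefficient -/

section HFBCSGrid

variable (L : ℕ) [NeZero L]

/-- **HF–BCS k-space cap at a grid field, rational gap coefficient** (`L ≥ 3`, any `U μ μ' β`, label `g`): with
`E_k = √((ε_k − μ')² + (4 g · dWaveGap k)²)`, `t_k = tanh(β E_k/2)`,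
`E₀(dWaveSourceTorus L U μ (√2 g)) ≤ (−Σ_k E_k t_k − μ' L²) + (μ' − μ) Σ_k (1 − ξ_k t_k/E_k) + U L² (Σ_k (1 − ξ_k t_k/E_k)/(2L²))²`
— `groundEnergy_dWaveSourceTorus_le_HFBCS_kSpace'` at `h = √2 g` with `2√2 h = 4 g`. This is EXACTLY the quantity the
certified menu table encloses (`S1`, `n` per `(L, β, μ', g)`). [cite: BachLiebSolovej1994, §2] -/
theorem groundEnergy_dWaveSourceTorus_sqrtTwoMul_le_HFBCS_kSpace (hL : 3 ≤ L) (U μ μ' β : ℝ) (g : ℚ) :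
    (dWaveSourceTorus L U μ (Real.sqrt 2 * (g : ℝ))).groundEnergy ≤
      (-(∑ k : TorusSite 2 L, Real.sqrt ((torusBand L k - μ') ^ 2 + (4 * (g : ℝ) * dWaveGap k) ^ 2) * Real.tanh (β * Real.sqrt ((torusBand L k - μ') ^ 2 + (4 * (g : ℝ) * dWaveGap k) ^ 2) / 2)) - μ' * (L : ℝ) ^ 2) +
        (μ' - μ) * (∑ k : TorusSite 2 L, (1 - (torusBand L k - μ') * Real.tanh (β * Real.sqrt ((torusBand L k - μ') ^ 2 + (4 * (g : ℝ) * dWaveGap k) ^ 2) / 2) / Real.sqrt ((torusBand L k - μ') ^ 2 + (4 * (g : ℝ) * dWaveGap k) ^ 2))) +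
        U * ((L : ℝ) ^ 2 *
          ((∑ k : TorusSite 2 L, (1 - (torusBand L k - μ') * Real.tanh (β * Real.sqrt ((torusBand L k - μ') ^ 2 + (4 * (g : ℝ) * dWaveGap k) ^ 2) / 2) / Real.sqrt ((torusBand L k - μ') ^ 2 + (4 * (g : ℝ) * dWaveGap k) ^ 2))) / (2 * (L : ℝ) ^ 2)) ^ 2) := by
  have key := groundEnergy_dWaveSourceTorus_le_HFBCS_kSpace' hL U μ μ' (Real.sqrt 2 * (g : ℝ)) β
  simp only [two_mul_sqrt_two_mul_sqrt_two_mul] at key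
  exact key

/-- **Certified grid numerics ⇒ sourced energy CEILING cell**: a certified inequality `RHS_{L,β,μ',g} ≤ φ·L²` for the
explicit momentum sum above gives `SourcedTorusEnergyUpperRow L 0 U μ (√2 g) φ`. [cite: BachLiebSolovej1994, §2] -/
theorem sourcedTorusEnergyUpperRow_sqrtTwoMul_of_kSpace_numerics (hL : 3 ≤ L) (U μ μ' β : ℝ) (g : ℚ) {φ : ℚ}
    (hnum : (-(∑ k : TorusSite 2 L, Real.sqrt ((torusBand L k - μ') ^ 2 + (4 * (g : ℝ) * dWaveGap k) ^ 2) * Real.tanh (β * Real.sqrt ((torusBand L k - μ') ^ 2 + (4 * (g : ℝ) * dWaveGap k) ^ 2) / 2)) - μ' * (L : ℝ) ^ 2) +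
        (μ' - μ) * (∑ k : TorusSite 2 L, (1 - (torusBand L k - μ') * Real.tanh (β * Real.sqrt ((torusBand L k - μ') ^ 2 + (4 * (g : ℝ) * dWaveGap k) ^ 2) / 2) / Real.sqrt ((torusBand L k - μ') ^ 2 + (4 * (g : ℝ) * dWaveGap k) ^ 2))) +
        U * ((L : ℝ) ^ 2 *
          ((∑ k : TorusSite 2 L, (1 - (torusBand L k - μ') * Real.tanh (β * Real.sqrt ((torusBand L k - μ') ^ 2 + (4 * (g : ℝ) * dWaveGap k) ^ 2) / 2) / Real.sqrt ((torusBand L k - μ') ^ 2 + (4 * (g : ℝ) * dWaveGap k) ^ 2))) / (2 * (L : ℝ) ^ 2)) ^ 2) ≤ ((φ : ℚ) : ℝ) * (L : ℝ) ^ 2) :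
    SourcedTorusEnergyUpperRow L 0 U μ (Real.sqrt 2 * (g : ℝ)) φ := by
  have hcap := (groundEnergy_dWaveSourceTorus_sqrtTwoMul_le_HFBCS_kSpace L hL U μ μ' β g).trans hnum
  rw [sourcedTorusEnergyUpperRow_iff, dWaveSourceTorusTT'_zero_tp]
  exact hcap

/-- **Grid response FLOOR from a source-free floor cell and certified HF–BCS grid numerics** (one torus `L ≥ 3`,
`t' = 0`, any real `U μ`, label `g > 0`): `hlo : SourcedTorusEnergyLowerRow L 0 U μ 0 lo` (pilot certificate) and the
certified k-space inequality at `√2 g` give `(lo − φ)/(2√2 g) ≤ m_L(√2 g) = dWaveSourceDensity L U μ (√2 g)`. Teeth iff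
`φ < lo`. [cite: KomaTasaki1994, §1] [cite: BachLiebSolovej1994, §2] -/
theorem dWaveSourceDensity_sqrtTwoMul_ge_of_lowerRow_of_kSpace_numerics (hL : 3 ≤ L) (U μ μ' β : ℝ) {g : ℚ}
    (hg : 0 < g) {lo φ : ℚ} (hlo : SourcedTorusEnergyLowerRow L 0 U μ 0 lo)
    (hnum : (-(∑ k : TorusSite 2 L, Real.sqrt ((torusBand L k - μ') ^ 2 + (4 * (g : ℝ) * dWaveGap k) ^ 2) * Real.tanh (β * Real.sqrt ((torusBand L k - μ') ^ 2 + (4 * (g : ℝ) * dWaveGap k) ^ 2) / 2)) - μ' * (L : ℝ) ^ 2) +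
        (μ' - μ) * (∑ k : TorusSite 2 L, (1 - (torusBand L k - μ') * Real.tanh (β * Real.sqrt ((torusBand L k - μ') ^ 2 + (4 * (g : ℝ) * dWaveGap k) ^ 2) / 2) / Real.sqrt ((torusBand L k - μ') ^ 2 + (4 * (g : ℝ) * dWaveGap k) ^ 2))) +
        U * ((L : ℝ) ^ 2 *
          ((∑ k : TorusSite 2 L, (1 - (torusBand L k - μ') * Real.tanh (β * Real.sqrt ((torusBand L k - μ') ^ 2 + (4 * (g : ℝ) * dWaveGap k) ^ 2) / 2) / Real.sqrt ((torusBand L k - μ') ^ 2 + (4 * (g : ℝ) * dWaveGap k) ^ 2))) / (2 * (L : ℝ) ^ 2)) ^ 2) ≤ ((φ : ℚ) : ℝ) * (L : ℝ) ^ 2) :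
    (((lo : ℚ) : ℝ) - ((φ : ℚ) : ℝ)) / (2 * (Real.sqrt 2 * (g : ℝ))) ≤ dWaveSourceDensity L U μ (Real.sqrt 2 * (g : ℝ)) :=
  dWaveSourceDensity_sqrtTwoMul_ge_of_rows L U μ hg hlo
    (sourcedTorusEnergyUpperRow_sqrtTwoMul_of_kSpace_numerics L hL U μ μ' β g hnum)

/-- **Grid response floor CELL with a rational slot from the same inputs**: `PinFieldTorusResponseFloor L 0 U μ (√2 g) m`
for every rational `m` with `0 ≤ lo − φ` and `8 g² m² ≤ (lo − φ)²` (both `norm_num`-decidable).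
[cite: KomaTasaki1994, §1] [cite: BachLiebSolovej1994, §2] -/
theorem pinFieldTorusResponseFloor_sqrtTwoMul_of_lowerRow_of_kSpace_numerics (hL : 3 ≤ L) (U μ μ' β : ℝ) {g : ℚ}
    (hg : 0 < g) {lo φ m : ℚ} (hlo : SourcedTorusEnergyLowerRow L 0 U μ 0 lo)
    (hnum : (-(∑ k : TorusSite 2 L, Real.sqrt ((torusBand L k - μ') ^ 2 + (4 * (g : ℝ) * dWaveGap k) ^ 2) * Real.tanh (β * Real.sqrt ((torusBand L k - μ') ^ 2 + (4 * (g : ℝ) * dWaveGap k) ^ 2) / 2)) - μ' * (L : ℝ) ^ 2) +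
        (μ' - μ) * (∑ k : TorusSite 2 L, (1 - (torusBand L k - μ') * Real.tanh (β * Real.sqrt ((torusBand L k - μ') ^ 2 + (4 * (g : ℝ) * dWaveGap k) ^ 2) / 2) / Real.sqrt ((torusBand L k - μ') ^ 2 + (4 * (g : ℝ) * dWaveGap k) ^ 2))) +
        U * ((L : ℝ) ^ 2 *
          ((∑ k : TorusSite 2 L, (1 - (torusBand L k - μ') * Real.tanh (β * Real.sqrt ((torusBand L k - μ') ^ 2 + (4 * (g : ℝ) * dWaveGap k) ^ 2) / 2) / Real.sqrt ((torusBand L k - μ') ^ 2 + (4 * (g : ℝ) * dWaveGap k) ^ 2))) / (2 * (L : ℝ) ^ 2)) ^ 2) ≤ ((φ : ℚ) : ℝ) * (L : ℝ) ^ 2)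
    (hs : 0 ≤ lo - φ) (hm : 8 * g ^ 2 * m ^ 2 ≤ (lo - φ) ^ 2) :
    PinFieldTorusResponseFloor L 0 U μ (Real.sqrt 2 * (g : ℝ)) m :=
  pinFieldTorusResponseFloor_sqrtTwoMul_of_rows L hg hlo
    (sourcedTorusEnergyUpperRow_sqrtTwoMul_of_kSpace_numerics L hL U μ μ' β g hnum) hs hm

end HFBCSGrid

/-! ### §3 Uniform in `L` at grid fields: the two-grid packaging, the floor leaf, the stair -/

section Uniform

/-- **UNIFORM-in-`L` HF–BCS cap row at a grid field** (`L₁ ≥ 3`, `β ≥ 0`, `U ≥ 0`, `g ≥ 0`): the two-grid packaging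
`sourcedEnergyUpperRow_of_HFBCS_kSpace_grid` at `h = √2 g` with the Lipschitz constants written rationally in `g`
(`2√2|h| = 4g`: `C₁ = 2π·(3/2)(2 + 4g)`, `C₂ = 2πβ(3 + 4g)`) and the rational gap coefficient: certified `L₁`-grid data
with `−(s₁ − 2C₁/L₁) − μ' + max_± [(μ'−μ)(n₁ ± 2C₂/L₁) + U(n₁ ± 2C₂/L₁)²/4] ≤ e` give `SourcedEnergyUpperRow 0 U μ (√2 g) 1 L₁ e`
(every side `L ≥ L₁`). [cite: DavisRabinowitz1984, §2.1 eq. (2.1.6)] [cite: BachLiebSolovej1994, §2] -/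
theorem sourcedEnergyUpperRow_sqrtTwoMul_of_kSpace_grid (L₁ : ℕ) [NeZero L₁] (hL₁ : 3 ≤ L₁) (U μ μ' β : ℝ)
    (hβ : 0 ≤ β) (hU : 0 ≤ U) {g : ℚ} (hg : 0 ≤ g) {e : ℚ}
    (hnum : (-(((∑ k : TorusSite 2 L₁, Real.sqrt ((torusBand L₁ k - μ') ^ 2 + (4 * (g : ℝ) * dWaveGap k) ^ 2) * Real.tanh (β * Real.sqrt ((torusBand L₁ k - μ') ^ 2 + (4 * (g : ℝ) * dWaveGap k) ^ 2) / 2)) / (L₁ : ℝ) ^ 2) - (2 * (2 * π * (3 / 2 * (2 + 4 * (g : ℝ)))) / (L₁ : ℝ))) - μ' +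
        max ((μ' - μ) * (((∑ k : TorusSite 2 L₁, (1 - (torusBand L₁ k - μ') * Real.tanh (β * Real.sqrt ((torusBand L₁ k - μ') ^ 2 + (4 * (g : ℝ) * dWaveGap k) ^ 2) / 2) / Real.sqrt ((torusBand L₁ k - μ') ^ 2 + (4 * (g : ℝ) * dWaveGap k) ^ 2))) / (L₁ : ℝ) ^ 2) - (2 * (2 * π * (β * (3 + 4 * (g : ℝ)))) / (L₁ : ℝ))) + U * (((∑ k : TorusSite 2 L₁, (1 - (torusBand L₁ k - μ') * Real.tanh (β * Real.sqrt ((torusBand L₁ k - μ') ^ 2 + (4 * (g : ℝ) * dWaveGap k) ^ 2) / 2) / Real.sqrt ((torusBand L₁ k - μ') ^ 2 + (4 * (g : ℝ) * dWaveGap k) ^ 2))) / (L₁ : ℝ) ^ 2) - (2 * (2 * π * (β * (3 + 4 * (g : ℝ)))) / (L₁ : ℝ))) ^ 2 / 4)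
            ((μ' - μ) * (((∑ k : TorusSite 2 L₁, (1 - (torusBand L₁ k - μ') * Real.tanh (β * Real.sqrt ((torusBand L₁ k - μ') ^ 2 + (4 * (g : ℝ) * dWaveGap k) ^ 2) / 2) / Real.sqrt ((torusBand L₁ k - μ') ^ 2 + (4 * (g : ℝ) * dWaveGap k) ^ 2))) / (L₁ : ℝ) ^ 2) + (2 * (2 * π * (β * (3 + 4 * (g : ℝ)))) / (L₁ : ℝ))) + U * (((∑ k : TorusSite 2 L₁, (1 - (torusBand L₁ k - μ') * Real.tanh (β * Real.sqrt ((torusBand L₁ k - μ') ^ 2 + (4 * (g : ℝ) * dWaveGap k) ^ 2) / 2) / Real.sqrt ((torusBand L₁ k - μ') ^ 2 + (4 * (g : ℝ) * dWaveGap k) ^ 2))) / (L₁ : ℝ) ^ 2) + (2 * (2 * π * (β * (3 + 4 * (g : ℝ)))) / (L₁ : ℝ))) ^ 2 / 4)) ≤ ((e : ℚ) : ℝ)) :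
    SourcedEnergyUpperRow 0 U μ (Real.sqrt 2 * (g : ℝ)) 1 L₁ e := by
  have key := sourcedEnergyUpperRow_of_HFBCS_kSpace_grid L₁ hL₁ U μ μ' (Real.sqrt 2 * (g : ℝ)) β hβ hU (e := e)
  have hg' : (0 : ℝ) ≤ (g : ℝ) := by exact_mod_cast hg
  simp only [two_mul_sqrt_two_mul_sqrt_two_mul, two_mul_sqrt_two_mul_abs_sqrt_two_mul hg'] at key
  exact key hnum

variable {tp U μ : ℝ} {q L₀ L₁ : ℕ}

/-- **Grid floor LEAF** (every side `L ≥ max L₀ L₁` with `q ∣ L`, any `t'`): uniform floor rows at `√2 g₁` and cap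
rows AT `√2 g` (`g₁ < g`) with a rational slot `m`, `0 ≤ lo − hi`, `8 (g − g₁)² m² ≤ (lo − hi)²`, give
`PinFieldResponseFloorAt tp U μ (√2 g) q (max L₀ L₁) m`. [cite: KomaTasaki1994, §1] [cite: Griffiths1966, §II] -/
theorem pinFieldResponseFloorAt_sqrtTwoGrid_of_rows {g₁ g lo hi m : ℚ} (hg : g₁ < g)
    (hlo : SourcedEnergyLowerRow tp U μ (Real.sqrt 2 * (g₁ : ℝ)) q L₀ lo)
    (hhi : SourcedEnergyUpperRow tp U μ (Real.sqrt 2 * (g : ℝ)) q L₁ hi)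
    (hs : 0 ≤ lo - hi) (hm : 8 * (g - g₁) ^ 2 * m ^ 2 ≤ (lo - hi) ^ 2) :
    PinFieldResponseFloorAt tp U μ (Real.sqrt 2 * (g : ℝ)) q (max L₀ L₁) m := by
  refine PinFieldResponseFloorAt.of_energyRows (sqrt_two_mul_ratCast_lt hg) hlo hhi ?_
  have h := ratCast_mul_two_sqrtTwoStep_le hs hm
  push_cast at h
  exact h

/-- **Grid floor LEAF from the source-free base** (`h₁ = 0`, the native shape of a window certificate, `q = 1` or any
`q`): `0 < g`, `0 ≤ lo − hi`, `8 g² m² ≤ (lo − hi)²` ⇒ `PinFieldResponseFloorAt tp U μ (√2 g) q (max L₀ L₁) m`.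
[cite: KomaTasaki1994, §1] [cite: Griffiths1966, §II] -/
theorem pinFieldResponseFloorAt_sqrtTwoMul_of_rows {g lo hi m : ℚ} (hg : 0 < g)
    (hlo : SourcedEnergyLowerRow tp U μ 0 q L₀ lo)
    (hhi : SourcedEnergyUpperRow tp U μ (Real.sqrt 2 * (g : ℝ)) q L₁ hi)
    (hs : 0 ≤ lo - hi) (hm : 8 * g ^ 2 * m ^ 2 ≤ (lo - hi) ^ 2) :
    PinFieldResponseFloorAt tp U μ (Real.sqrt 2 * (g : ℝ)) q (max L₀ L₁) m := by
  refine PinFieldResponseFloorAt.of_energyRows (sqrt_two_mul_ratCast_pos hg) hlo hhi ?_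
  have h := ratCast_mul_two_sqrtTwoMul_le hs hm
  push_cast at h
  exact h

/-- **Grid ceiling LEAF**: cap rows AT `√2 g` and floor rows at `√2 g₂` (`g < g₂`), `0 ≤ M`, `(hi − lo)² ≤ 8 (g₂ − g)² M²`
⇒ `PinFieldResponseCeilingAt tp U μ (√2 g) q (max L₁ L₀) M` (hence an order-parameter ceiling for `g > 0`,
`PinFieldResponseCeilingAt.dWaveOrderParameterTT'_le`). Never speaks to presence. [cite: KomaTasaki1994, §1] -/
theorem pinFieldResponseCeilingAt_sqrtTwoGrid_of_rows {g g₂ hi lo M : ℚ} (hg : g < g₂)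
    (hhi : SourcedEnergyUpperRow tp U μ (Real.sqrt 2 * (g : ℝ)) q L₁ hi)
    (hlo : SourcedEnergyLowerRow tp U μ (Real.sqrt 2 * (g₂ : ℝ)) q L₀ lo)
    (hM : 0 ≤ M) (hsM : (hi - lo) ^ 2 ≤ 8 * (g₂ - g) ^ 2 * M ^ 2) :
    PinFieldResponseCeilingAt tp U μ (Real.sqrt 2 * (g : ℝ)) q (max L₁ L₀) M := by
  refine PinFieldResponseCeilingAt.of_energyRows (sqrt_two_mul_ratCast_lt hg) hhi hlo ?_
  have h := ratCast_le_mul_two_sqrtTwoStep hg.le hM hsM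
  push_cast at h
  exact h

/-- **Grid STAIR floor** (all sides, `q = 1`): the same rows give `m ≤ liminf_L m_{L+1}(√2 g)` for the tracial stair
`dWaveSourceDensityTT' · tp U μ (√2 g)` — a finite-field response floor in the thermodynamic limit; NOT the order
parameter (an infimum over all `h > 0`). [cite: KomaTasaki1994, §1] -/
theorem le_liminf_dWaveSourceDensityTT'_sqrtTwoMul_of_rows {g lo hi m : ℚ} (hg : 0 < g)
    (hlo : SourcedEnergyLowerRow tp U μ 0 1 L₀ lo)
    (hhi : SourcedEnergyUpperRow tp U μ (Real.sqrt 2 * (g : ℝ)) 1 L₁ hi)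
    (hs : 0 ≤ lo - hi) (hm : 8 * g ^ 2 * m ^ 2 ≤ (lo - hi) ^ 2) :
    ((m : ℚ) : ℝ) ≤ liminf (fun L : ℕ => dWaveSourceDensityTT' (L + 1) tp U μ (Real.sqrt 2 * (g : ℝ))) atTop :=
  (pinFieldResponseFloorAt_sqrtTwoMul_of_rows hg hlo hhi hs hm).le_liminf

/-- **Grid stair floor, THRESHOLD form with real slots, `t' = 0`** (the delivered shapes: a window-certificate floor
`∀ L ≥ L₀, lo·L² ≤ E₀(A_L(0))` and a uniform cap `∀ L ≥ L₁, E₀(A_L(√2 g)) ≤ φ·L²`):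
`(lo − φ)/(2√2 g) ≤ liminf_L m_{L+1}(√2 g)`. [cite: KomaTasaki1994, §1] -/
theorem le_liminf_dWaveSourceDensity_sqrtTwoMul_of_thresholds (U μ : ℝ) {g : ℚ} (hg : 0 < g) {lo φ : ℝ}
    (hlo : ∀ L : ℕ, L₀ ≤ L → ∀ [NeZero L], lo * (L : ℝ) ^ 2 ≤ (dWaveSourceTorus L U μ 0).groundEnergy)
    (hcap : ∀ L : ℕ, L₁ ≤ L → ∀ [NeZero L],
      (dWaveSourceTorus L U μ (Real.sqrt 2 * (g : ℝ))).groundEnergy ≤ φ * (L : ℝ) ^ 2) :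
    (lo - φ) / (2 * (Real.sqrt 2 * (g : ℝ))) ≤
      liminf (fun L : ℕ => dWaveSourceDensity (L + 1) U μ (Real.sqrt 2 * (g : ℝ))) atTop := by
  have h := le_liminf_dWaveSourceDensity_of_thresholds U μ (sqrt_two_mul_ratCast_pos hg) hlo hcap
  rwa [sub_zero] at h

end Uniform

end Summit.Ventures.CertifiedManyBodySolver.Observables

end
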